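import Mathlib
import Summits.Ventures.HodgeRepro.Tier4.Common.KTypeProjectorAdjoint
import Summits.Ventures.HodgeRepro.Tier4.Common.TestProjector
import Summits.Ventures.HodgeRepro.Tier4.Common.RowWeights

/-!
# Tier4/Common/TestProjectorVanishing — `R(e ⋆ f ⋆ e) ψ = 0` for `ψ ⊥ e ψ` (the `hvan` shape for the projected test
function), `R(e ⋆ f ⋆ e) φ` lies in the `(C, χ)`-type, and the transport of the row-plane characters to a
TRANSPORTED torus

Blind re-derivation cell `pub-hodge-repro`, Tier 4 «prove the step» (README §9–§10), seat t4-typer-2 (gen 3).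
Target tree path `lean/Summits/Ventures/HodgeRepro/Tier4/Common/TestProjectorVanishing.lean`.  Mathlib +
`Common.{KTypeProjectorAdjoint, TestProjector, RowWeights}`; no literature.

WHY (plan-4 S13921 CUT C-L4-PROJ: «whence (s) (`kProj` lands in the type space) and `hvan` (`kProj` kills the
orthogonal complement)»; and the plane question «the seesaw plane is `(mixedRow q a₀ a₂).withTransportedTorus g g′`,
say if that is inside your RowTorus block description, else name what is missing»).
* **`integral_biProj_mul_eq_zero_of_orthogonal`** — for `f₁ := e ⋆ f ⋆ e` and a continuous left-`Γ`-invariant `ψ` with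
  `⟨ψ, e_{C,χ} ψ⟩_D = 0`: `R(f₁) ψ = 0` (KTypeProjectorAdjoint's `integral_mul_eq_zero_of_orthogonal` with the
  bi-equivariance `biProj_apply_mul`);
* **`integral_biProj_mul_apply_mul`** — `R(e ⋆ f ⋆ e) φ` is right-`(C, χ)`-equivariant (it IS `e_{C,χ}(…)`,
  `kProj_apply_mul`): the (s) shape — the output lies in the `(C, χ)`-type;
* **`weightAt'_mul_of_conj`, `norm_weightAt'_eq_one_of_conj`** — on a plane `W'` whose transported torus is
  conjugate into the torus of a ROW plane `W₂ = ofLinesRow q a b ε` by `g, g′` (the DISPLAYED similitude fact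
  `hconj : ∀ κ ∈ localTorusAt' W' w', ∃ κ' ∈ torusT W₂, GA.mat W₂ κ' = adMat k g' * GA.mat W' κ * adMat k g`), the
  transported weights `weightAt' W' q w g g' j` are multiplicative and unit-modulus on `localTorusAt' W' w'` — the
  `hχ` / `hu` of the projector for the `T′`-side of L4's seesaw plane `(mixedRow q a₀ a₂).withTransportedTorus g g′`:
  its `T′` is `g T(mixedRow q a₁ a₃) g⁻¹`, inside the block description of RowTorus once `hconj` (the similitude
  `g B' gᵀ = λ B` of the skeleton) is displayed by the line.

Nothing here says anything about the status of the Hodge conjecture for CM abelian varieties, which is NOT proved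
(HC_CM is NOT proved by anyone in this repository).
-/

set_option autoImplicit false

noncomputable section

namespace Summit.Ventures.HodgeRepro.Tier4.Common

open MeasureTheory Measure Topology Set NumberField
open scoped ComplexConjugate

section Vanishing

variable {G : Type*} [Group G] [TopologicalSpace G] [IsTopologicalGroup G] [MeasurableSpace G] [BorelSpace G]
  [SecondCountableTopology G] [LocallyCompactSpace G] [FirstCountableTopology G] (C : Subgroup G) (ν : Measure C)
  (μ : Measure G)

/-- **The `hvan` shape for `f₁ := e ⋆ f ⋆ e`**: `R(e ⋆ f ⋆ e) ψ = 0` for a continuous left-`Γ`-invariant `ψ`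
orthogonal to `e_{C,χ} ψ` over the fundamental domain `D`. -/
theorem integral_biProj_mul_eq_zero_of_orthogonal [CompactSpace C] [ν.IsHaarMeasure] [IsProbabilityMeasure ν]
    [SFinite μ] [μ.IsMulLeftInvariant] [μ.IsMulRightInvariant] [IsFiniteMeasureOnCompacts μ] {χ : G → ℂ}
    (hχc : Continuous fun κ : C => χ κ) (hχ : ∀ a ∈ C, ∀ b ∈ C, χ (a * b) = χ a * χ b)
    (hu : ∀ a ∈ C, ‖χ a‖ = 1) (Γ : Subgroup G) [Countable Γ] {D : Set G} (fd : IsFundamentalDomain Γ D μ)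
    (hDc : IsCompact (closure D)) {f ψ : G → ℂ} (hf : Continuous f) (hfc : HasCompactSupport f)
    (hψ : Continuous ψ) (hψΓ : ∀ (γ : Γ) (x : G), ψ ((γ : G) * x) = ψ x)
    (horth : ∫ x in D, ψ x * conj (kProj C ν χ ψ x) ∂μ = 0) (x : G) :
    ∫ y, biProj C ν χ f y * ψ (x * y) ∂μ = 0 := by
  haveI := isMulRightInvariant_of_compactSpace ν
  obtain ⟨hc, hcs⟩ := isTestFn_biProj C ν hχc hf hfc
  exact integral_mul_eq_zero_of_orthogonal C ν μ hχc hχ hu Γ fd hDc hc hcs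
    (fun y κ hκ => biProj_apply_mul C ν hχ hu f y hκ) hψ hψΓ horth x

/-- **`R(e ⋆ f ⋆ e) φ` lies in the `(C, χ)`-type** (the (s) shape): it is `e_{C,χ}` of something, hence
right-`(C, χ)`-equivariant. -/
theorem integral_biProj_mul_apply_mul [CompactSpace C] [ν.IsHaarMeasure] [IsProbabilityMeasure ν] [SFinite μ]
    [μ.IsMulLeftInvariant] [μ.IsMulRightInvariant] [IsFiniteMeasureOnCompacts μ] {χ : G → ℂ}
    (hχc : Continuous fun κ : C => χ κ) (hχ : ∀ a ∈ C, ∀ b ∈ C, χ (a * b) = χ a * χ b)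
    (hu : ∀ a ∈ C, ‖χ a‖ = 1) {f φ : G → ℂ} (hf : Continuous f) (hfc : HasCompactSupport f) (hφ : Continuous φ)
    (x : G) {κ₀ : G} (hκ₀ : κ₀ ∈ C) :
    ∫ y, biProj C ν χ f y * φ (x * κ₀ * y) ∂μ = χ κ₀ * ∫ y, biProj C ν χ f y * φ (x * y) ∂μ := by
  rw [integral_biProj_mul_eq C ν μ hχc hχ hu hf hfc hφ (x * κ₀), integral_biProj_mul_eq C ν μ hχc hχ hu hf hfc hφ x]
  exact kProj_apply_mul C ν hχ hu _ x hκ₀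

end Vanishing

section Transport

variable {k : Type} [Field k] [NumberField k] (q : QuadData k) (a b ε : k) (w : InfinitePlace k)

/-- **The transported weights are multiplicative on a transported local torus conjugate into a row torus**: if every
`κ ∈ localTorusAt' W' w'` has a conjugate `κ' ∈ torusT (ofLinesRow q a b ε)` with `mat κ' = g′ (mat κ) g`, then
`weightAt' W' q w g g' j` is multiplicative on `localTorusAt' W' w'` (real CM place `w`). -/
theorem weightAt'_mul_of_conj (ha : a ≠ 0) (hb : b ≠ 0) (hε : ε ≠ 0) (hw : w.IsReal) (hcm : IsCMAt q w)
    (W' : PlaneData k) (g g' : Matrix (Fin 4) (Fin 4) k) (hgg' : adMat k g * adMat k g' = 1)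
    (w' : InfinitePlace k)
    (hconj : ∀ κ ∈ localTorusAt' W' w', ∃ κ' ∈ torusT (PlaneData.ofLinesRow q a b ε),
      GA.mat (PlaneData.ofLinesRow q a b ε) κ' = adMat k g' * GA.mat W' κ * adMat k g) (j : Fin 2) :
    ∀ κ₁ ∈ localTorusAt' W' w', ∀ κ₂ ∈ localTorusAt' W' w',
      weightAt' W' q w g g' j (κ₁ * κ₂) = weightAt' W' q w g g' j κ₁ * weightAt' W' q w g g' j κ₂ := by
  intro κ₁ hκ₁ κ₂ hκ₂
  obtain ⟨κ₁', hκ₁', h₁⟩ := hconj κ₁ hκ₁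
  obtain ⟨κ₂', hκ₂', h₂⟩ := hconj κ₂ hκ₂
  have h12 : GA.mat (PlaneData.ofLinesRow q a b ε) (κ₁' * κ₂') =
      adMat k g' * GA.mat W' (κ₁ * κ₂) * adMat k g := by
    rw [GA.mat_mul, GA.mat_mul, h₁, h₂]
    calc adMat k g' * GA.mat W' κ₁ * adMat k g * (adMat k g' * GA.mat W' κ₂ * adMat k g)
        = adMat k g' * GA.mat W' κ₁ * (adMat k g * adMat k g') * GA.mat W' κ₂ * adMat k g := by
          simp only [Matrix.mul_assoc]
      _ = adMat k g' * (GA.mat W' κ₁ * GA.mat W' κ₂) * adMat k g := by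
          rw [hgg', Matrix.mul_one]
          simp only [Matrix.mul_assoc]
  rw [weightAt'_eq_weightAt_of_mat q w _ W' g g' (κ₁ * κ₂) (κ₁' * κ₂') h12 j,
    weightAt'_eq_weightAt_of_mat q w _ W' g g' κ₁ κ₁' h₁ j, weightAt'_eq_weightAt_of_mat q w _ W' g g' κ₂ κ₂' h₂ j]
  exact weightAt_mul q a b ε w ha hb hε hw hcm j hκ₁' hκ₂'

/-- **The transported weights have modulus one on a transported local torus conjugate into a row torus.** -/
theorem norm_weightAt'_eq_one_of_conj (ha : a ≠ 0) (hb : b ≠ 0) (hε : ε ≠ 0) (hw : w.IsReal) (hcm : IsCMAt q w)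
    (W' : PlaneData k) (g g' : Matrix (Fin 4) (Fin 4) k) (w' : InfinitePlace k)
    (hconj : ∀ κ ∈ localTorusAt' W' w', ∃ κ' ∈ torusT (PlaneData.ofLinesRow q a b ε),
      GA.mat (PlaneData.ofLinesRow q a b ε) κ' = adMat k g' * GA.mat W' κ * adMat k g) (j : Fin 2) :
    ∀ κ ∈ localTorusAt' W' w', ‖weightAt' W' q w g g' j κ‖ = 1 := by
  intro κ hκ
  obtain ⟨κ', hκ', h⟩ := hconj κ hκ
  rw [weightAt'_eq_weightAt_of_mat q w _ W' g g' κ κ' h j]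
  exact norm_weightAt_eq_one q a b ε w ha hb hε hw hcm j hκ'

/-- The product character `weightAt' … 0 ^ e₊ · weightAt' … 1 ^ e₋` of the `kTypeSpace'` clause is multiplicative on
the transported local torus (same hypotheses). -/
theorem weightChar'_mul_of_conj (ha : a ≠ 0) (hb : b ≠ 0) (hε : ε ≠ 0) (hw : w.IsReal) (hcm : IsCMAt q w)
    (W' : PlaneData k) (g g' : Matrix (Fin 4) (Fin 4) k) (hgg' : adMat k g * adMat k g' = 1)
    (w' : InfinitePlace k)
    (hconj : ∀ κ ∈ localTorusAt' W' w', ∃ κ' ∈ torusT (PlaneData.ofLinesRow q a b ε),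
      GA.mat (PlaneData.ofLinesRow q a b ε) κ' = adMat k g' * GA.mat W' κ * adMat k g) (ePlus eMinus : ℤ) :
    ∀ κ₁ ∈ localTorusAt' W' w', ∀ κ₂ ∈ localTorusAt' W' w',
      weightAt' W' q w g g' 0 (κ₁ * κ₂) ^ ePlus * weightAt' W' q w g g' 1 (κ₁ * κ₂) ^ eMinus =
        (weightAt' W' q w g g' 0 κ₁ ^ ePlus * weightAt' W' q w g g' 1 κ₁ ^ eMinus) *
          (weightAt' W' q w g g' 0 κ₂ ^ ePlus * weightAt' W' q w g g' 1 κ₂ ^ eMinus) := by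
  intro κ₁ hκ₁ κ₂ hκ₂
  rw [weightAt'_mul_of_conj q a b ε w ha hb hε hw hcm W' g g' hgg' w' hconj 0 κ₁ hκ₁ κ₂ hκ₂,
    weightAt'_mul_of_conj q a b ε w ha hb hε hw hcm W' g g' hgg' w' hconj 1 κ₁ hκ₁ κ₂ hκ₂, mul_zpow, mul_zpow]
  ring

/-- The product character has modulus one on the transported local torus (same hypotheses). -/
theorem norm_weightChar'_eq_one_of_conj (ha : a ≠ 0) (hb : b ≠ 0) (hε : ε ≠ 0) (hw : w.IsReal) (hcm : IsCMAt q w)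
    (W' : PlaneData k) (g g' : Matrix (Fin 4) (Fin 4) k) (w' : InfinitePlace k)
    (hconj : ∀ κ ∈ localTorusAt' W' w', ∃ κ' ∈ torusT (PlaneData.ofLinesRow q a b ε),
      GA.mat (PlaneData.ofLinesRow q a b ε) κ' = adMat k g' * GA.mat W' κ * adMat k g) (ePlus eMinus : ℤ) :
    ∀ κ ∈ localTorusAt' W' w', ‖weightAt' W' q w g g' 0 κ ^ ePlus * weightAt' W' q w g g' 1 κ ^ eMinus‖ = 1 := by
  intro κ hκ
  rw [norm_mul, norm_zpow, norm_zpow, norm_weightAt'_eq_one_of_conj q a b ε w ha hb hε hw hcm W' g g' w' hconj 0 κ hκ,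
    norm_weightAt'_eq_one_of_conj q a b ε w ha hb hε hw hcm W' g g' w' hconj 1 κ hκ, _root_.one_zpow,
    _root_.one_zpow, one_mul]

end Transport

end Summit.Ventures.HodgeRepro.Tier4.Common

end
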